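import Mathlib

/-!
# Crux `AveragedTypeIBlowup` (stmt-NavierStokesRegularity-1835), negative side: uniform-damping conjugacy for quadratic gates

Negative-side (cdisprove, D-0016) structural ODE lemma extracted from
`Cruxes/AveragedTypeIBlowup/Disproof.lean` (v3, §11); it is the kernel-checked content of ideator
note N1 (`Cruxes/AveragedTypeIBlowup/NegativeNotesIdeator1.md`) and of the "fire-or-die is a theorem
of the caricature" step of the threshold lines for this crux (Tao 2016 §5 quadratic circuits
`∂ₜX = G(X,X)`, (4.3) with dissipation).

* `hasDerivAt_uniformDamping_conj` — for a continuous bilinear map `G` on a real normed space and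
  `D > 0`: if `Y' = G(Y,Y)` on the effective-time window `[0, 1/D)`, then
  `X(t) := e^{-Dt} Y(τ(t))`, `τ(t) = (1 - e^{-Dt})/D` (`effTime`), solves the UNIFORMLY DAMPED
  system `X' = -D X + G(X,X)` for every `t ≥ 0`.

Reading: a quadratic gate all of whose modes are damped at ONE rate is the inviscid gate run for the
finite effective time `1/D` with amplitudes multiplied by `1 - Dτ`; inviscid events at time `τ_c`
happen in the damped gate iff `τ_c < 1/D`; energy fractions delivered by such a gate are
amplitude-blind at first order in the viscous fraction, so the Type-I fixed point of an
amplitude-blind cascade is repelling (a saddle — enough for the `∃`-crux by shooting, not an open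
basin), and "attracting Type-I" designs must read an inter-scale damping contrast. ODE uniqueness
(identifying the damped solution from `Y(0)` with this `X`) is not formalised here. Nothing here
closes the item (`--supports`); no statement of the route is asserted or changed.

## References

* T. Tao, J. Amer. Math. Soc. 29 (2016), 601–674, arXiv:1402.0290v3, §5 (quadratic circuits
  (5.1)–(5.2); Prop. 5.1 rescaling p. 26), §4 (4.3). [`Tao2016AveragedNS`]
-/

noncomputable section

namespace Summit.NavierStokesRegularity.NavierStokesRegularity.Theorems.AveragedTypeIBlowup.Negative

open Set Filter Topology

/-- The effective (inviscid) time of the uniformly damped flow: `τ(t) = (1 - e^{-Dt})/D`. [folklore] -/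
def effTime (D t : ℝ) : ℝ := (1 - Real.exp (-(D * t))) / D

/-- `d/ds (-(D s)) = -D`. [folklore] -/
theorem hasDerivAt_neg_mul (D t : ℝ) : HasDerivAt (fun s : ℝ => -(D * s)) (-D) t := by
  have h := ((hasDerivAt_id t).const_mul D).neg
  simp only [id_eq, mul_one] at h
  exact h

/-- `d/ds e^{-Ds} = -D e^{-Ds}`. [folklore] -/
theorem hasDerivAt_exp_neg_mul (D t : ℝ) :
    HasDerivAt (fun s : ℝ => Real.exp (-(D * s))) (Real.exp (-(D * t)) * -D) t :=
  (Real.hasDerivAt_exp _).comp t (hasDerivAt_neg_mul D t)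

/-- `τ'(t) = e^{-Dt}`. [folklore] -/
theorem hasDerivAt_effTime {D : ℝ} (hD : D ≠ 0) (t : ℝ) :
    HasDerivAt (effTime D) (Real.exp (-(D * t))) t := by
  unfold effTime
  have h3 : HasDerivAt (fun s : ℝ => (1 - Real.exp (-(D * s))) / D)
      ((0 - Real.exp (-(D * t)) * -D) / D) t :=
    ((hasDerivAt_const t (1 : ℝ)).sub (hasDerivAt_exp_neg_mul D t)).div_const D
  convert h3 using 1
  field_simp
  ring

/-- For `t ≥ 0` and `D > 0` the effective time lies in `[0, 1/D)`. [folklore] -/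
theorem effTime_mem_Ico {D : ℝ} (hD : 0 < D) {t : ℝ} (ht : 0 ≤ t) : effTime D t ∈ Ico 0 (1 / D) := by
  unfold effTime
  have hexp : 0 < Real.exp (-(D * t)) := Real.exp_pos _
  have hle : Real.exp (-(D * t)) ≤ 1 := Real.exp_le_one_iff.mpr (by nlinarith)
  constructor
  · exact div_nonneg (by linarith) hD.le
  · exact div_lt_div_of_pos_right (by linarith) hD

/-- **Uniform-damping conjugacy (N1 of the ideator notes, kernel-checked).** Let `G` be a
continuous bilinear map on a real normed space and `D > 0`. If `Y` solves the INVISCID quadratic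
system `Y' = G(Y,Y)` on the effective-time window `[0, 1/D)`, then
`X(t) := e^{-Dt} Y(τ(t))`, `τ(t) = (1 - e^{-Dt})/D`, solves the UNIFORMLY DAMPED system
`X' = -D X + G(X,X)` for all `t ≥ 0`. Consequences (with ODE uniqueness, not formalised here): the
damped flow with datum `X(0) = Y(0)` is the inviscid flow run for the finite effective time
`τ < 1/D` with amplitudes multiplied by `e^{-Dt} = 1 - Dτ`; an inviscid event at time `τ_c`
(ignition, completion of a transfer) happens in the damped system iff `τ_c < 1/D` ("fire or die"),
and every energy FRACTION delivered by a single uniformly damped gate is independent of the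
amplitude at first order — which is why amplitude-blind chains have a REPELLING Type-I fixed point
and why "attracting Type-I" designs must read an inter-scale damping contrast. [folklore] -/
theorem hasDerivAt_uniformDamping_conj {E : Type*} [NormedAddCommGroup E] [NormedSpace ℝ E]
    (G : E →L[ℝ] E →L[ℝ] E) {D : ℝ} (hD : 0 < D) {Y : ℝ → E}
    (hY : ∀ τ ∈ Ico 0 (1 / D), HasDerivAt Y (G (Y τ) (Y τ)) τ) {t : ℝ} (ht : 0 ≤ t) :
    HasDerivAt (fun s => Real.exp (-(D * s)) • Y (effTime D s))
      (-(D • (Real.exp (-(D * t)) • Y (effTime D t))) +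
        G (Real.exp (-(D * t)) • Y (effTime D t)) (Real.exp (-(D * t)) • Y (effTime D t))) t := by
  have hτ := hasDerivAt_effTime hD.ne' t
  have hYτ : HasDerivAt Y (G (Y (effTime D t)) (Y (effTime D t))) (effTime D t) :=
    hY _ (effTime_mem_Ico hD ht)
  have hcomp : HasDerivAt (fun s => Y (effTime D s))
      (Real.exp (-(D * t)) • G (Y (effTime D t)) (Y (effTime D t))) t :=
    hYτ.scomp t hτ
  have key : HasDerivAt (fun s => Real.exp (-(D * s)) • Y (effTime D s))
      (Real.exp (-(D * t)) • (Real.exp (-(D * t)) • G (Y (effTime D t)) (Y (effTime D t))) +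
        (Real.exp (-(D * t)) * -D) • Y (effTime D t)) t :=
    (hasDerivAt_exp_neg_mul D t).smul hcomp
  refine key.congr_deriv ?_
  have hG : G (Real.exp (-(D * t)) • Y (effTime D t)) (Real.exp (-(D * t)) • Y (effTime D t)) =
      Real.exp (-(D * t)) • (Real.exp (-(D * t)) • G (Y (effTime D t)) (Y (effTime D t))) := by
    rw [G.map_smul]
    change Real.exp (-(D * t)) • G (Y (effTime D t)) (Real.exp (-(D * t)) • Y (effTime D t)) = _
    rw [(G (Y (effTime D t))).map_smul]
  rw [hG, mul_neg, neg_smul, mul_comm (Real.exp (-(D * t))) D, ← smul_smul]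
  abel

end Summit.NavierStokesRegularity.NavierStokesRegularity.Theorems.AveragedTypeIBlowup.Negative

end
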